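/-
Copyright (c) 2026 the pub-hodgecm-mathlib formalisation cell (harness21).  Prover seat hodgecm-mathlib-K2Liu-p14 (g4), Track B «K2-LIT»,
#184♮ = hLiu418 = `stmt-HodgeConjecture-24832`; socket #41, KIND 1 (K1-b♮ LINE TERM), organ (K1b-W) «KIND W AT `n := 1` FOR THE PULLED-BACK
FAMILY» — LEAD F0P6-plan (g14) BATCH #77 (1) (2026-09-04T22:27:31Z), K1 desk F0P2-p11 (g2) memo `CENSUS-K1-DealTable.F0P2-p11-g2.md` §2;
this seat's FILE CUT 22:32:01Z, file (KW1-a).  THEOREMS ONLY (no `def`, no `instance`, no notation, no named-fact hypothesis, no `sorry`).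
-/
import Summits.HodgeConjecture.HodgeConjecture.Theorems.K2LiuIntertwiningConverges        -- ★ O41.3 `integrable_weylDelta_mul` (generic `n`), ★ `norm_siegelDeltaCharacter`
import Summits.HodgeConjecture.HodgeConjecture.Theorems.K2LiuSiegelUnipotentCharacters     -- ★ Φ1 `whittakerDelta`, `continuous_unipDeltaChar_coe`, `norm_conj_unipDeltaChar_mul`
import Literature.Analysis.Complex.HolomorphicParametricIntegral                           -- ★ `differentiableOn_integral_of_dominated` (Cauchy estimates, no derivative data)
import HarnessLib

/-!
# Crux `HLiu418`, socket #41, KIND 1 ∕ organ (K1b-W), file (KW1-a): THE TWISTED BIG-CELL INTEGRAL `s ↦ W_S(f_s)(x)` OF A STANDARD FAMILY IS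
# HOLOMORPHIC ON GODEMENT'S HALF-PLANE `{n∕2 < re s}` — generic `n`; at `n = 1` and inner parameter `s + ½` this is the whole of `{0 < re s}`

Cell `hodgecm-mathlib`, crux item hLiu418 = `stmt-HodgeConjecture-24832` (helper lane `--supports … --as helper`, count-neutral), route of record
`HCCMUnconditional`; squad K2 ∕ K2Liu, road `K2_Liu`, socket #41 `sig_K2LiuSiegelEisensteinContinuation`, KIND 1 = the rank-one Fourier indices.
After ★ `K2LiuKindOneLettersOfRecord` ∕ ★ `K2LiuKindOneWeightsOfDecay` the K1-b♮ LINE TERM `Ebc` owes four letters about ONE function; by the K1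
desk's road ((T4-α) ★ p862495 → (T4-β) → (K1b-W) → assembly) `Ebc S s h` is, up to the constants of record, the RANK-ONE twisted big-cell integral
`W⁽¹⁾_{μ_S}(Φ_s)(x)` on the doubled LINE `H₁ = U(𝕍₁ ⊕ −𝕍₁)` (datum `e₁ = Equiv.prodUnique (Fin 1) (Fin 1)`) of the PULLED-BACK standard family `Φ`,
a Siegel section of `I⁽¹⁾(s + ½, χ)` — INNER PARAMETER `s + ½`.  KEY FACT of this organ: at `n = 1` Godement's half-plane `{n∕2 < re s′}` read at
`s′ = s + ½` is ALL of `{0 < re s}`, so the rank-one global Whittaker integral CONVERGES on the whole window and «continued = integral»: the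
holomorphy letter `hEbd` ∕ `hAd₁` needs no continuation, only holomorphic dependence of an absolutely convergent parameter integral.
THIS FILE proves exactly that, GENERIC in `n` (so it is also the (W2) engine of the KIND-W lineage wherever the `T`-part is read as an integral),
for an ABSTRACT family given by four letters — sections at inner parameter `s + c`, holomorphy, continuity, and a VERTICAL-STRIP ENVELOPE
`‖Φ s y‖ ≤ C · (‖Φ σ₀ y‖ + ‖Φ σ₁ y‖)` (`σ₀ ≤ re s ≤ σ₁`) — which standard families satisfy with `C = 1` and which survive the corner pull-back
`x ↦ f s (p₀ · ι x · g)` of the K1-b♮ road ((KW1-e) `K2LiuKindOneLineWhittakerTranslate`, F0P2-p10 (g2)):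
* §1 **`differentiableOn_whittakerDelta_of_dominated`** — ABSTRACT: `s ↦ f s g` holomorphic on an open `U` for every `g`, `f s` continuous, and near
  each `z ∈ U` ONE `νN`-integrable majorant of `u ↦ f s (w_Δ u x)` uniform in `s` ⇒ `s ↦ whittakerDelta νN S (f s) x` is `DifferentiableOn ℂ U`
  (★ `Literature.Analysis.Complex.differentiableOn_integral_of_dominated`; the twist `conj ψ_S` is unimodular, ★ `norm_conj_unipDeltaChar_mul`).
* §2 **THE TWO-ENDPOINT ENVELOPE.**  (a) `norm_apply_le_add_of_re_mem_Icc`: for a STANDARD family `f` (★ `IsStandardSectionFamily`: `f_s(p k) = χ_s(p) f_0(k)`,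
  ★ `apply_delta_mul`) and unitary `χ`, `‖χ_s(p)‖ = modDelta(p)^{2 re s + n}` (★ `norm_siegelDeltaCharacter`) is CONVEX-MONOTONE in `re s`: for
  `re s₀ ≤ re s ≤ re s₁` and EVERY `y ∈ H(𝔸)`, `‖f s y‖ ≤ ‖f s₀ y‖ + ‖f s₁ y‖` (base `≤ 1`: the `s₀` end; base `≥ 1`: the `s₁` end) — no geometry of the big
  cell; (b) `norm_siegelDeltaCharacter_le_add` — the same for the scalar `χ_s(p₀)`; (c) **`envelope_of_norm_eq_mul`** — TRANSFER: if `‖Φ s x‖ = ‖c s‖ · ‖F s (ι x)‖`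
  with `F` enveloped (constant `C_F`) on the big group, `ι` ANY map, and the scalar `c` two-endpoint bounded and non-zero at the endpoints, then `Φ` is
  enveloped with constant `C_F · (1 + ‖c σ₀‖∕‖c σ₁‖ + ‖c σ₁‖∕‖c σ₀‖)` — exactly the shape of the corner translate `χ_s(p₀) · f s (blkD(1,x) · g)`.
* §3 **`differentiableOn_whittakerDelta_of_envelope`** — THE ORGAN'S (W2): sections of `I(s + c, χ)` (unitary `χ`), `s ↦ Φ s y` holomorphic on the window,
  `Φ s` continuous, enveloped on every strip inside the window, `νN` Haar, `dV dW ≠ 0` ⇒ `s ↦ W_S(Φ_s)(x)` is holomorphic on `{n∕2 − re c < re s}` for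
  EVERY index `S` and EVERY `x ∈ H(𝔸)` — the majorant near `z` is `C · (‖Φ σ₀ (w_Δ u x)‖ + ‖Φ σ₁ (w_Δ u x)‖)`, `σ₀ = re z − R`, `σ₁ = re z + R`, both summands
  integrable by ★ O41.3 `integrable_weylDelta_mul` (`σᵢ + re c > n∕2`).  `differentiableOn_whittakerDelta_of_isStandardSectionFamily` — the standard case
  (`c = 0`, `C = 1`): holomorphic on Godement's half-plane `{n∕2 < re s}`.
* §4 **THE SHIFTED WINDOW** (`differentiableOn_whittakerDelta_shift`, `…_shift_halfPlane`, `…_line_shift_half`): a standard family READ at `s + c` is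
  holomorphic on `{n∕2 − re c < re s}`; at `re c ≥ n∕2` on `{0 < re s}`; the organ's case `n = 1`, `c = ½` LITERALLY — the `hEbd` ∕ `hAd₁` SHAPE of
  TOP ED. 16 ∕ ★ p862451, by name.
[MoeglinWaldspurger1995, II.1.6–II.1.7, IV.1.9] [KudlaRallis1994, §1–§2] [Tan1999, §1, §3] [Garrett2018, §3.10] [Conway1978, IV §2].
HONEST LABEL.  Count-neutral helper, hypothesis-free but socket-free: it closes no socket by itself; `HC_CM` is proved only modulo the 7 printed
citations (2 remaining named inputs: hLiu418 = `stmt-HodgeConjecture-24832`, h413 = `stmt-HodgeConjecture-24833`) until rung 0 closes.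

## References
* [MoeglinWaldspurger1995] C. Mœglin, J.-L. Waldspurger, *Spectral decomposition and Eisenstein series*, CUP (1995): II.1.6–II.1.7 (absolute
  convergence of intertwining ∕ Whittaker integrals on Godement's half-plane), IV.1.9 (holomorphy of the coefficients).
* [KudlaRallis1994] S. Kudla, S. Rallis, Ann. of Math. 140 (1994): §1–§2 (standard sections, `W_β(g, s, Φ)` holomorphic on the half-plane).
* [Tan1999] V. Tan, Canad. J. Math. 51 (1999): §1 (standard sections `f_s(pk) = χ_s(p) f(k)`), §3.
* [Garrett2018] P. Garrett, *Modern Analysis of Automorphic Forms by Example* (2018): §3.10 (domination on vertical strips by the endpoints).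
* [Conway1978] J. B. Conway, *Functions of One Complex Variable I*, GTM 11: Ch. IV §2 (Leibniz rule for holomorphic parameter integrals).
-/

set_option autoImplicit false
-- the mandated namespace repeats the single-problem summit's segment (`HodgeConjecture.HodgeConjecture`)
set_option linter.dupNamespace false

noncomputable section

open scoped Matrix ENNReal NNReal ComplexConjugate
open NumberField IsDedekindDomain MeasureTheory Measure Metric Set

namespace Summit.HodgeConjecture.HodgeConjecture.Cruxes.HLiu418.K2LiuKindOneLineWhittakerHolomorphy

open Literature.NumberTheory.Automorphic Literature.NumberTheory.Automorphic.UnitaryGroup Literature.NumberTheory.GaloisRepresentations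
open Literature.NumberTheory.GelbartRogawski1991 Literature.NumberTheory.GelbartRogawski1991.GRConstruction
open Literature.NumberTheory.K2Lit.SiegelDoubled
open Summit.HodgeConjecture.HodgeConjecture.Cruxes.HLiu418.K2LiuSiegelUnipotentFourierDefs
open Summit.HodgeConjecture.HodgeConjecture.Cruxes.HLiu418.K2LiuSiegelUnipotentCharacters
open Summit.HodgeConjecture.HodgeConjecture.Cruxes.HLiu418.K2LiuSiegelEisensteinDoubledSummableReduction (norm_siegelDeltaCharacter)
open Summit.HodgeConjecture.HodgeConjecture.Cruxes.HLiu418.K2LiuIntertwiningConverges (integrable_weylDelta_mul)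

variable (L : Type) [Field L] [NumberField L] [IsCMField L]
variable {N M n : ℕ} (e : Fin N × Fin M ≃ Fin n)
  (dV : Fin N → L) (hdV : ∀ i, IsCMField.complexConj L (dV i) = dV i)
  (dW : Fin M → L) (hdW : ∀ i, IsCMField.complexConj L (dW i) = dW i)

/-! ## §1 Abstract: holomorphy of the twisted big-cell integral under a locally uniform integrable majorant -/

section Dominated

variable [MeasurableSpace (unipDelta L e dV hdV dW hdW)] [BorelSpace (unipDelta L e dV hdV dW hdW)]

/-- **HOLOMORPHY OF `s ↦ W_S(f_s)(x)` UNDER DOMINATION.**  `f : ℂ → H(𝔸) → ℂ` with `s ↦ f s g` holomorphic on the open `U` for every `g` and `f s`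
continuous for `s ∈ U`; `νN` any measure on `N_Δ(𝔸)`; and for every `z ∈ U` a radius `R > 0` and ONE `νN`-integrable `bound` with
`‖f s (w_Δ u x)‖ ≤ bound u` for all `u` and all `s` with `dist s z < R`.  Then `s ↦ whittakerDelta νN S (f s) x` is `DifferentiableOn ℂ U`
(the twist `conj ψ_S(u)` is continuous and unimodular; ★ `differentiableOn_integral_of_dominated` — Cauchy estimates, no derivative data).
[cite: Conway1978, IV §2] [cite: MoeglinWaldspurger1995, IV.1.9] -/
theorem differentiableOn_whittakerDelta_of_dominated (νN : Measure (unipDelta L e dV hdV dW hdW)) {U : Set ℂ} (hU : IsOpen U)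
    (f : ℂ → HA L e dV hdV dW hdW → ℂ) (hfd : ∀ g, DifferentiableOn ℂ (fun s => f s g) U) (hfc : ∀ s ∈ U, Continuous (f s))
    (S : Matrix (Fin n) (Fin n) L) (x : HA L e dV hdV dW hdW)
    (hdom : ∀ z ∈ U, ∃ R > (0 : ℝ), ∃ bound : unipDelta L e dV hdV dW hdW → ℝ, Integrable bound νN ∧
      ∀ s, dist s z < R → ∀ u : unipDelta L e dV hdV dW hdW, ‖f s (weylDelta L e dV hdV dW hdW * (u : HA L e dV hdV dW hdW) * x)‖ ≤ bound u) :
    DifferentiableOn ℂ (fun s => whittakerDelta L e dV hdV dW hdW νN S (f s) x) U := by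
  have hrw : (fun s => whittakerDelta L e dV hdV dW hdW νN S (f s) x) = fun s => ∫ u, conj (unipDeltaChar L e dV hdV dW hdW S (u : HA L e dV hdV dW hdW) : ℂ) *
      f s (weylDelta L e dV hdV dW hdW * (u : HA L e dV hdV dW hdW) * x) ∂νN := by
    funext s; rw [whittakerDelta_def]
  rw [hrw]
  have hψ : Continuous fun u : unipDelta L e dV hdV dW hdW => (conj (unipDeltaChar L e dV hdV dW hdW S (u : HA L e dV hdV dW hdW) : ℂ) : ℂ) :=
    Complex.continuous_conj.comp (continuous_unipDeltaChar_coe L e dV hdV dW hdW S)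
  have ha : Continuous fun u : unipDelta L e dV hdV dW hdW => weylDelta L e dV hdV dW hdW * (u : HA L e dV hdV dW hdW) * x :=
    (continuous_const.mul continuous_subtype_val).mul continuous_const
  refine Literature.Analysis.Complex.differentiableOn_integral_of_dominated
    (F := fun s (u : unipDelta L e dV hdV dW hdW) => conj (unipDeltaChar L e dV hdV dW hdW S (u : HA L e dV hdV dW hdW) : ℂ) *
      f s (weylDelta L e dV hdV dW hdW * (u : HA L e dV hdV dW hdW) * x)) (U := U) ?_ ?_ ?_
  · intro s hs
    exact (hψ.mul ((hfc s hs).comp ha)).aestronglyMeasurable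
  · exact Filter.Eventually.of_forall fun u => (differentiableOn_const _).mul (hfd _)
  · intro z hz
    obtain ⟨R₁, hR₁, bound, hbound, hle⟩ := hdom z hz
    obtain ⟨R₂, hR₂, hR₂U⟩ := Metric.isOpen_iff.1 hU z hz
    refine ⟨min R₁ R₂, lt_min hR₁ hR₂, (ball_subset_ball (min_le_right _ _)).trans hR₂U, bound, hbound, ?_⟩
    refine Filter.Eventually.of_forall fun u s hs => ?_
    rw [norm_conj_unipDeltaChar_mul]
    exact hle s (lt_of_lt_of_le (mem_ball.1 hs) (min_le_left _ _)) u

end Dominated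

/-! ## §2 The two-endpoint envelope: standard families, the inducing scalar, and its transfer along a pull-back -/

section Endpoints

variable {L e dV hdV dW hdW}

/-- **convex monotonicity of a positive real power**: for `0 < m` and `a ≤ t ≤ b`, `m ^ t ≤ m ^ a + m ^ b` (base `≤ 1`: `m^t ≤ m^a`; base `≥ 1`: `m^t ≤ m^b`).
[folklore] -/
theorem rpow_le_rpow_add_rpow {m : ℝ} (hm : 0 < m) {a t b : ℝ} (hat : a ≤ t) (htb : t ≤ b) : m ^ t ≤ m ^ a + m ^ b := by
  rcases le_total m 1 with h1 | h1
  · exact (Real.rpow_le_rpow_of_exponent_ge hm h1 hat).trans (le_add_of_nonneg_right (Real.rpow_nonneg hm.le _))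
  · exact (Real.rpow_le_rpow_of_exponent_le h1 htb).trans (le_add_of_nonneg_left (Real.rpow_nonneg hm.le _))

/-- **the inducing scalar is two-endpoint bounded**: for unitary `χ` and `re s₀ ≤ re s ≤ re s₁`, `‖χ_s(p)‖ ≤ ‖χ_{s₀}(p)‖ + ‖χ_{s₁}(p)‖` (every `p`;
★ `norm_siegelDeltaCharacter` + `rpow_le_rpow_add_rpow`). [cite: Tan1999, §1] [cite: Garrett2018, §3.10] -/
theorem norm_siegelDeltaCharacter_le_add {χ : HeckeCharacter L} (hχ : χ.IsUnitary) {s₀ s s₁ : ℂ} (h₀ : s₀.re ≤ s.re) (h₁ : s.re ≤ s₁.re)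
    (p : HA L e dV hdV dW hdW) :
    ‖siegelDeltaCharacter L e dV hdV dW hdW χ s p‖ ≤ ‖siegelDeltaCharacter L e dV hdV dW hdW χ s₀ p‖ + ‖siegelDeltaCharacter L e dV hdV dW hdW χ s₁ p‖ := by
  rw [norm_siegelDeltaCharacter L e dV hdV dW hdW hχ, norm_siegelDeltaCharacter L e dV hdV dW hdW hχ, norm_siegelDeltaCharacter L e dV hdV dW hdW hχ]
  refine rpow_le_rpow_add_rpow (modDelta_pos L e dV hdV dW hdW p) ?_ ?_ <;> linarith

/-- the inducing scalar never vanishes (unitary `χ`; its norm is a positive real power). [cite: Tan1999, §1] -/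
theorem norm_siegelDeltaCharacter_pos {χ : HeckeCharacter L} (hχ : χ.IsUnitary) (s : ℂ) (p : HA L e dV hdV dW hdW) :
    0 < ‖siegelDeltaCharacter L e dV hdV dW hdW χ s p‖ := by
  rw [norm_siegelDeltaCharacter L e dV hdV dW hdW hχ]
  exact Real.rpow_pos_of_pos (modDelta_pos L e dV hdV dW hdW p) _

/-- **THE TWO-ENDPOINT ENVELOPE OF A STANDARD FAMILY.**  `f` a STANDARD family of Siegel sections for the Iwasawa datum `𝒦` (★ `IsStandardSectionFamily`:
holomorphic, `K`-finite, FLAT) and `χ` unitary: for `re s₀ ≤ re s ≤ re s₁` and every `y ∈ H(𝔸)`, `‖f s y‖ ≤ ‖f s₀ y‖ + ‖f s₁ y‖`.  Proof: `y = p k` (Iwasawa),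
`f_s(p k) = χ_s(p) f_0(k)` (★ `apply_delta_mul`), and `norm_siegelDeltaCharacter_le_add`.  No geometry of the big cell is used.
[cite: Tan1999, §1] [cite: Garrett2018, §3.10] -/
theorem norm_apply_le_add_of_re_mem_Icc {𝒦 : IwasawaDatum L e dV hdV dW hdW} {χ : HeckeCharacter L} (hχ : χ.IsUnitary)
    {f : ℂ → HA L e dV hdV dW hdW → ℂ} (hf : IsStandardSectionFamily 𝒦 χ f) {s₀ s s₁ : ℂ} (h₀ : s₀.re ≤ s.re) (h₁ : s.re ≤ s₁.re)
    (y : HA L e dV hdV dW hdW) : ‖f s y‖ ≤ ‖f s₀ y‖ + ‖f s₁ y‖ := by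
  obtain ⟨p, k, hp, hk, rfl⟩ := 𝒦.iwasawa y
  rw [hf.apply_delta_mul s 0 hp hk, hf.apply_delta_mul s₀ 0 hp hk, hf.apply_delta_mul s₁ 0 hp hk, norm_mul, norm_mul, norm_mul, ← add_mul]
  exact mul_le_mul_of_nonneg_right (norm_siegelDeltaCharacter_le_add hχ h₀ h₁ p) (norm_nonneg _)

/-- **TRANSFER OF THE ENVELOPE ALONG A PULL-BACK WITH A SCALAR** (the corner-translate shape `Φ s x = χ_s(p₀) · f s (blkD(1,x) · g)` of (KW1-e)).  `X`, `Y`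
any types, `ι : X → Y` ANY map, `F : ℂ → Y → ℂ` enveloped on the strip `[σ₀, σ₁]` with constant `C_F`, `c : ℂ → ℂ` two-endpoint bounded on the strip and
non-zero at both endpoints, and `‖Φ s x‖ = ‖c s‖ · ‖F s (ι x)‖` identically.  THEN `Φ` is enveloped on the strip with the constant
`C_F · (1 + ‖c σ₀‖∕‖c σ₁‖ + ‖c σ₁‖∕‖c σ₀‖)`. [cite: Garrett2018, §3.10] [folklore] -/
theorem envelope_of_norm_eq_mul {X Y : Type*} (ι : X → Y) {F : ℂ → Y → ℂ} {Φ : ℂ → X → ℂ} {c : ℂ → ℂ} {σ₀ σ₁ : ℝ} {CF : ℝ} (hCF : 0 ≤ CF)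
    (hF : ∀ s : ℂ, σ₀ ≤ s.re → s.re ≤ σ₁ → ∀ Y' : Y, ‖F s Y'‖ ≤ CF * (‖F (σ₀ : ℂ) Y'‖ + ‖F (σ₁ : ℂ) Y'‖))
    (hc : ∀ s : ℂ, σ₀ ≤ s.re → s.re ≤ σ₁ → ‖c s‖ ≤ ‖c (σ₀ : ℂ)‖ + ‖c (σ₁ : ℂ)‖) (hc₀ : c (σ₀ : ℂ) ≠ 0) (hc₁ : c (σ₁ : ℂ) ≠ 0)
    (hΦ : ∀ (s : ℂ) (x : X), ‖Φ s x‖ = ‖c s‖ * ‖F s (ι x)‖) :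
    ∀ s : ℂ, σ₀ ≤ s.re → s.re ≤ σ₁ → ∀ x : X,
      ‖Φ s x‖ ≤ CF * (1 + ‖c (σ₀ : ℂ)‖ / ‖c (σ₁ : ℂ)‖ + ‖c (σ₁ : ℂ)‖ / ‖c (σ₀ : ℂ)‖) * (‖Φ (σ₀ : ℂ) x‖ + ‖Φ (σ₁ : ℂ) x‖) := by
  intro s h₀ h₁ x
  set a₀ : ℝ := ‖c (σ₀ : ℂ)‖ with ha₀
  set a₁ : ℝ := ‖c (σ₁ : ℂ)‖ with ha₁
  set b₀ : ℝ := ‖F (σ₀ : ℂ) (ι x)‖ with hb₀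
  set b₁ : ℝ := ‖F (σ₁ : ℂ) (ι x)‖ with hb₁
  have ha₀p : 0 < a₀ := norm_pos_iff.2 hc₀
  have ha₁p : 0 < a₁ := norm_pos_iff.2 hc₁
  have hb₀n : 0 ≤ b₀ := norm_nonneg _
  have hb₁n : 0 ≤ b₁ := norm_nonneg _
  rw [hΦ s x, hΦ (σ₀ : ℂ) x, hΦ (σ₁ : ℂ) x]
  -- `‖c s‖ ‖F s Y‖ ≤ (a₀ + a₁) · C_F (b₀ + b₁)` and `(a₀ + a₁)(b₀ + b₁) ≤ (1 + a₀∕a₁ + a₁∕a₀)(a₀ b₀ + a₁ b₁)`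
  have h1 : ‖c s‖ * ‖F s (ι x)‖ ≤ (a₀ + a₁) * (CF * (b₀ + b₁)) :=
    mul_le_mul (hc s h₀ h₁) (hF s h₀ h₁ (ι x)) (norm_nonneg _) (by positivity)
  have h2 : a₀ * b₁ ≤ a₀ / a₁ * (a₀ * b₀ + a₁ * b₁) := by
    have : a₀ / a₁ * (a₁ * b₁) = a₀ * b₁ := by field_simp
    nlinarith [mul_nonneg (div_nonneg ha₀p.le ha₁p.le) (mul_nonneg ha₀p.le hb₀n)]
  have h3 : a₁ * b₀ ≤ a₁ / a₀ * (a₀ * b₀ + a₁ * b₁) := by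
    have : a₁ / a₀ * (a₀ * b₀) = a₁ * b₀ := by field_simp
    nlinarith [mul_nonneg (div_nonneg ha₁p.le ha₀p.le) (mul_nonneg ha₁p.le hb₁n)]
  calc ‖c s‖ * ‖F s (ι x)‖ ≤ (a₀ + a₁) * (CF * (b₀ + b₁)) := h1
    _ = CF * ((a₀ * b₀ + a₁ * b₁) + a₀ * b₁ + a₁ * b₀) := by ring
    _ ≤ CF * ((a₀ * b₀ + a₁ * b₁) + a₀ / a₁ * (a₀ * b₀ + a₁ * b₁) + a₁ / a₀ * (a₀ * b₀ + a₁ * b₁)) := by gcongr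
    _ = CF * (1 + a₀ / a₁ + a₁ / a₀) * (a₀ * b₀ + a₁ * b₁) := by ring

/-- on the ball `dist s z < R` the real part stays in the strip `[re z − R, re z + R]`. [folklore] -/
theorem re_mem_Icc_of_dist_lt {s z : ℂ} {R : ℝ} (hs : dist s z < R) : z.re - R ≤ s.re ∧ s.re ≤ z.re + R := by
  have h : |s.re - z.re| < R := lt_of_le_of_lt (by simpa using Complex.abs_re_le_norm (s - z)) (by rwa [dist_eq_norm] at hs)
  constructor <;> [linarith [(abs_lt.1 h).1]; linarith [(abs_lt.1 h).2]]

end Endpoints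

/-! ## §3 The twisted big-cell integral of an enveloped family of sections is holomorphic on its window -/

section Envelope

variable [MeasurableSpace (unipDelta L e dV hdV dW hdW)] [BorelSpace (unipDelta L e dV hdV dW hdW)]

/-- **(W2) OF THE ORGAN — `s ↦ W_S(Φ_s)(x)` IS HOLOMORPHIC ON `{n∕2 − re c < re s}` FOR AN ENVELOPED FAMILY OF SECTIONS AT INNER PARAMETER `s + c`**
(generic `n`; every index `S`, every `x ∈ H(𝔸)`).  LETTERS: `Φ s ∈ I(s + c, χ)` (`χ` unitary) for every `s`; `s ↦ Φ s y` holomorphic on the window for every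
`y`; `Φ s` continuous; and for every strip `σ₀ ≤ σ₁` inside the window a constant `C` with `‖Φ s y‖ ≤ C · (‖Φ σ₀ y‖ + ‖Φ σ₁ y‖)` (`σ₀ ≤ re s ≤ σ₁`, all `y`);
`νN` a Haar measure on `N_Δ(𝔸)`; `dV, dW ≠ 0`.  PROOF: §1 with, near `z` (`R` = half the distance to the edge), the majorant `C · (‖Φ σ₀ (w_Δ u x)‖ +
‖Φ σ₁ (w_Δ u x)‖)`, `σ₀ = re z − R`, `σ₁ = re z + R`, each summand integrable by ★ O41.3 `integrable_weylDelta_mul` (continuous sections at `σᵢ + c`,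
`re > n∕2`). [cite: KudlaRallis1994, §1–§2] [cite: MoeglinWaldspurger1995, II.1.6–II.1.7, IV.1.9] [cite: Tan1999, §3] -/
theorem differentiableOn_whittakerDelta_of_envelope (hdV0 : ∀ i, dV i ≠ 0) (hdW0 : ∀ i, dW i ≠ 0)
    {χ : HeckeCharacter L} (hχ : χ.IsUnitary) (c : ℂ) {Φ : ℂ → HA L e dV hdV dW hdW → ℂ}
    (hsec : ∀ s : ℂ, IsSiegelDeltaSection L e dV hdV dW hdW χ (s + c) (Φ s))
    (hhol : ∀ y, DifferentiableOn ℂ (fun s => Φ s y) {s : ℂ | (n : ℝ) / 2 - c.re < s.re}) (hcont : ∀ s, Continuous (Φ s))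
    (henv : ∀ σ₀ σ₁ : ℝ, (n : ℝ) / 2 - c.re < σ₀ → σ₀ ≤ σ₁ → ∃ C : ℝ, ∀ s : ℂ, σ₀ ≤ s.re → s.re ≤ σ₁ →
      ∀ y : HA L e dV hdV dW hdW, ‖Φ s y‖ ≤ C * (‖Φ (σ₀ : ℂ) y‖ + ‖Φ (σ₁ : ℂ) y‖))
    (νN : Measure (unipDelta L e dV hdV dW hdW)) [νN.IsHaarMeasure] (S : Matrix (Fin n) (Fin n) L) (x : HA L e dV hdV dW hdW) :
    DifferentiableOn ℂ (fun s => whittakerDelta L e dV hdV dW hdW νN S (Φ s) x) {s : ℂ | (n : ℝ) / 2 - c.re < s.re} := by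
  refine differentiableOn_whittakerDelta_of_dominated L e dV hdV dW hdW νN (isOpen_lt continuous_const Complex.continuous_re) Φ hhol
    (fun s _ => hcont s) S x fun z hz => ?_
  have hz' : (n : ℝ) / 2 - c.re < z.re := hz
  set R : ℝ := (z.re - ((n : ℝ) / 2 - c.re)) / 2 with hR
  have hR0 : 0 < R := by rw [hR]; linarith
  have hσ₀w : (n : ℝ) / 2 - c.re < z.re - R := by rw [hR]; linarith
  obtain ⟨C, hC⟩ := henv (z.re - R) (z.re + R) hσ₀w (by linarith)
  have hσ₀ : (n : ℝ) / 2 < (((z.re - R : ℝ) : ℂ) + c).re := by rw [Complex.add_re, Complex.ofReal_re]; linarith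
  have hσ₁ : (n : ℝ) / 2 < (((z.re + R : ℝ) : ℂ) + c).re := by rw [Complex.add_re, Complex.ofReal_re]; linarith
  refine ⟨R, hR0, fun u => C * (‖Φ ((z.re - R : ℝ) : ℂ) (weylDelta L e dV hdV dW hdW * (u : HA L e dV hdV dW hdW) * x)‖ +
      ‖Φ ((z.re + R : ℝ) : ℂ) (weylDelta L e dV hdV dW hdW * (u : HA L e dV hdV dW hdW) * x)‖), ?_, fun s hs u => ?_⟩
  · exact ((integrable_weylDelta_mul L e dV hdV dW hdW hdV0 hdW0 hχ hσ₀ (hsec _) (hcont _) νN x).norm.add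
      (integrable_weylDelta_mul L e dV hdV dW hdW hdV0 hdW0 hχ hσ₁ (hsec _) (hcont _) νN x).norm).const_mul C
  · obtain ⟨h₀, h₁⟩ := re_mem_Icc_of_dist_lt hs
    exact hC s h₀ h₁ _

/-- **THE STANDARD CASE (`c = 0`, `C = 1`): `s ↦ W_S(f_s)(x)` IS HOLOMORPHIC ON GODEMENT'S HALF-PLANE `{n∕2 < re s}`** for a standard family `f` (★
`IsStandardSectionFamily`) with continuous members, unitary `χ`, `νN` Haar, `dV dW ≠ 0` — every index `S`, every `x ∈ H(𝔸)`; envelope by §2 (a).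
[cite: KudlaRallis1994, §1–§2] [cite: MoeglinWaldspurger1995, II.1.6–II.1.7, IV.1.9] [cite: Tan1999, §3] -/
theorem differentiableOn_whittakerDelta_of_isStandardSectionFamily (hdV0 : ∀ i, dV i ≠ 0) (hdW0 : ∀ i, dW i ≠ 0)
    {𝒦 : IwasawaDatum L e dV hdV dW hdW} {χ : HeckeCharacter L} (hχ : χ.IsUnitary)
    {f : ℂ → HA L e dV hdV dW hdW → ℂ} (hf : IsStandardSectionFamily 𝒦 χ f) (hfc : ∀ s, Continuous (f s))
    (νN : Measure (unipDelta L e dV hdV dW hdW)) [νN.IsHaarMeasure] (S : Matrix (Fin n) (Fin n) L) (x : HA L e dV hdV dW hdW) :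
    DifferentiableOn ℂ (fun s => whittakerDelta L e dV hdV dW hdW νN S (f s) x) {s : ℂ | (n : ℝ) / 2 < s.re} := by
  have h := differentiableOn_whittakerDelta_of_envelope L e dV hdV dW hdW hdV0 hdW0 hχ 0 (Φ := f) (fun s => by rw [add_zero]; exact hf.1.1 s)
    (fun y => (hf.1.2 y).differentiableOn) hfc
    (fun σ₀ σ₁ _ _ => ⟨1, fun s h₀ h₁ y => by
      rw [one_mul]
      exact norm_apply_le_add_of_re_mem_Icc hχ hf (by rwa [Complex.ofReal_re]) (by rwa [Complex.ofReal_re]) y⟩) νN S x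
  simpa only [Complex.zero_re, sub_zero] using h

/-- the same read on any SMALLER set (e.g. a consumer's window inside Godement's half-plane). [cite: MoeglinWaldspurger1995, IV.1.9] -/
theorem differentiableOn_whittakerDelta_of_isStandardSectionFamily_mono (hdV0 : ∀ i, dV i ≠ 0) (hdW0 : ∀ i, dW i ≠ 0)
    {𝒦 : IwasawaDatum L e dV hdV dW hdW} {χ : HeckeCharacter L} (hχ : χ.IsUnitary)
    {f : ℂ → HA L e dV hdV dW hdW → ℂ} (hf : IsStandardSectionFamily 𝒦 χ f) (hfc : ∀ s, Continuous (f s))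
    (νN : Measure (unipDelta L e dV hdV dW hdW)) [νN.IsHaarMeasure] (S : Matrix (Fin n) (Fin n) L) (x : HA L e dV hdV dW hdW)
    {U : Set ℂ} (hU : U ⊆ {s : ℂ | (n : ℝ) / 2 < s.re}) :
    DifferentiableOn ℂ (fun s => whittakerDelta L e dV hdV dW hdW νN S (f s) x) U :=
  (differentiableOn_whittakerDelta_of_isStandardSectionFamily L e dV hdV dW hdW hdV0 hdW0 hχ hf hfc νN S x).mono hU

end Envelope

/-! ## §4 The shifted window: a standard family read at inner parameter `s + c` (the organ's case `n = 1`, `c = ½`: the whole of `{0 < re s}`) -/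

section Shift

variable [MeasurableSpace (unipDelta L e dV hdV dW hdW)] [BorelSpace (unipDelta L e dV hdV dW hdW)]

/-- **INNER PARAMETER `s + c`**: for a standard family `f` (at its native parameter), `s ↦ W_S(f_{s+c})(x)` is holomorphic on `{n∕2 − re c < re s}` —
§3 for the family `s ↦ f (s + c)` (sections at `s + c`; envelope `C = 1` by §2 (a), the endpoints `σᵢ + c` having real parts `σᵢ + re c`).
[cite: KudlaRallis1994, §1–§2] [cite: MoeglinWaldspurger1995, IV.1.9] -/
theorem differentiableOn_whittakerDelta_shift (hdV0 : ∀ i, dV i ≠ 0) (hdW0 : ∀ i, dW i ≠ 0)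
    {𝒦 : IwasawaDatum L e dV hdV dW hdW} {χ : HeckeCharacter L} (hχ : χ.IsUnitary)
    {f : ℂ → HA L e dV hdV dW hdW → ℂ} (hf : IsStandardSectionFamily 𝒦 χ f) (hfc : ∀ s, Continuous (f s))
    (νN : Measure (unipDelta L e dV hdV dW hdW)) [νN.IsHaarMeasure] (S : Matrix (Fin n) (Fin n) L) (x : HA L e dV hdV dW hdW) (c : ℂ) :
    DifferentiableOn ℂ (fun s => whittakerDelta L e dV hdV dW hdW νN S (f (s + c)) x) {s : ℂ | (n : ℝ) / 2 - c.re < s.re} :=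
  differentiableOn_whittakerDelta_of_envelope L e dV hdV dW hdW hdV0 hdW0 hχ c (Φ := fun s => f (s + c)) (fun s => hf.1.1 (s + c))
    (fun y => ((hf.1.2 y).comp (differentiable_id.add_const c)).differentiableOn) (fun s => hfc (s + c))
    (fun σ₀ σ₁ _ _ => ⟨1, fun s h₀ h₁ y => by
      rw [one_mul]
      refine norm_apply_le_add_of_re_mem_Icc hχ hf ?_ ?_ y <;>
        simp only [Complex.add_re, Complex.ofReal_re] <;> linarith⟩) νN S x

/-- **THE `hEbd` ∕ `hAd₁` SHAPE: holomorphy on `{0 < re s}` at inner parameter `s + c` whenever `n∕2 ≤ re c`** — the organ's case is the doubled LINE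
`n = 1` with `c = ½` (a standard family `Φ` of `I⁽¹⁾(·, χ)` read at `s + ½`): `s ↦ W⁽¹⁾_μ(Φ_{s+½})(x)` is holomorphic on the whole window `{0 < re s}`,
for every line index `μ` and every `x ∈ H₁(𝔸)`; NO continuation is involved. [cite: KudlaRallis1994, §1–§2] [cite: Tan1999, §3] [cite: MoeglinWaldspurger1995, IV.1.9] -/
theorem differentiableOn_whittakerDelta_shift_halfPlane (hdV0 : ∀ i, dV i ≠ 0) (hdW0 : ∀ i, dW i ≠ 0)
    {𝒦 : IwasawaDatum L e dV hdV dW hdW} {χ : HeckeCharacter L} (hχ : χ.IsUnitary)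
    {f : ℂ → HA L e dV hdV dW hdW → ℂ} (hf : IsStandardSectionFamily 𝒦 χ f) (hfc : ∀ s, Continuous (f s))
    (νN : Measure (unipDelta L e dV hdV dW hdW)) [νN.IsHaarMeasure] (S : Matrix (Fin n) (Fin n) L) (x : HA L e dV hdV dW hdW)
    {c : ℂ} (hc : (n : ℝ) / 2 ≤ c.re) :
    DifferentiableOn ℂ (fun s => whittakerDelta L e dV hdV dW hdW νN S (f (s + c)) x) {s : ℂ | 0 < s.re} :=
  (differentiableOn_whittakerDelta_shift L e dV hdV dW hdW hdV0 hdW0 hχ hf hfc νN S x c).mono fun s hs => by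
    have hs' : 0 < s.re := hs
    show (n : ℝ) / 2 - c.re < s.re
    linarith

/-- the enveloped edition of the same window: sections at `s + c` with `n∕2 ≤ re c`, holomorphic ∕ continuous ∕ enveloped on the strips of `{0 < re s}`
⇒ `s ↦ W_S(Φ_s)(x)` is holomorphic on `{0 < re s}` (the corner-translate family of (KW1-e) is of this kind, envelope by §2 (c)).
[cite: KudlaRallis1994, §1–§2] [cite: MoeglinWaldspurger1995, IV.1.9] -/
theorem differentiableOn_whittakerDelta_of_envelope_halfPlane (hdV0 : ∀ i, dV i ≠ 0) (hdW0 : ∀ i, dW i ≠ 0)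
    {χ : HeckeCharacter L} (hχ : χ.IsUnitary) {c : ℂ} (hc : (n : ℝ) / 2 ≤ c.re) {Φ : ℂ → HA L e dV hdV dW hdW → ℂ}
    (hsec : ∀ s : ℂ, IsSiegelDeltaSection L e dV hdV dW hdW χ (s + c) (Φ s))
    (hhol : ∀ y, DifferentiableOn ℂ (fun s => Φ s y) {s : ℂ | (n : ℝ) / 2 - c.re < s.re}) (hcont : ∀ s, Continuous (Φ s))
    (henv : ∀ σ₀ σ₁ : ℝ, (n : ℝ) / 2 - c.re < σ₀ → σ₀ ≤ σ₁ → ∃ C : ℝ, ∀ s : ℂ, σ₀ ≤ s.re → s.re ≤ σ₁ →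
      ∀ y : HA L e dV hdV dW hdW, ‖Φ s y‖ ≤ C * (‖Φ (σ₀ : ℂ) y‖ + ‖Φ (σ₁ : ℂ) y‖))
    (νN : Measure (unipDelta L e dV hdV dW hdW)) [νN.IsHaarMeasure] (S : Matrix (Fin n) (Fin n) L) (x : HA L e dV hdV dW hdW) :
    DifferentiableOn ℂ (fun s => whittakerDelta L e dV hdV dW hdW νN S (Φ s) x) {s : ℂ | 0 < s.re} :=
  (differentiableOn_whittakerDelta_of_envelope L e dV hdV dW hdW hdV0 hdW0 hχ c hsec hhol hcont henv νN S x).mono fun s hs => by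
    have hs' : 0 < s.re := hs
    show (n : ℝ) / 2 - c.re < s.re
    linarith

/-- **THE RANK-ONE LETTER, LITERALLY** (`n = 1`, `c = 1∕2`): for the doubled line datum `e₁ : Fin N₁ × Fin M₁ ≃ Fin 1` and a standard family `Φ` there,
`s ↦ W⁽¹⁾_μ(Φ_{s + 1∕2})(x)` is `DifferentiableOn ℂ {0 < re s}`. [cite: KudlaRallis1994, §1–§2] [cite: Tan1999, §3 (`n = 1`)] -/
theorem differentiableOn_whittakerDelta_line_shift_half {N₁ M₁ : ℕ} (e₁ : Fin N₁ × Fin M₁ ≃ Fin 1)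
    (d₁ : Fin N₁ → L) (hd₁ : ∀ i, IsCMField.complexConj L (d₁ i) = d₁ i) (w₁ : Fin M₁ → L) (hw₁ : ∀ i, IsCMField.complexConj L (w₁ i) = w₁ i)
    [MeasurableSpace (unipDelta L e₁ d₁ hd₁ w₁ hw₁)] [BorelSpace (unipDelta L e₁ d₁ hd₁ w₁ hw₁)]
    (hd0 : ∀ i, d₁ i ≠ 0) (hw0 : ∀ i, w₁ i ≠ 0)
    {𝒦 : IwasawaDatum L e₁ d₁ hd₁ w₁ hw₁} {χ : HeckeCharacter L} (hχ : χ.IsUnitary)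
    {Φ : ℂ → HA L e₁ d₁ hd₁ w₁ hw₁ → ℂ} (hΦ : IsStandardSectionFamily 𝒦 χ Φ) (hΦc : ∀ s, Continuous (Φ s))
    (ν₁ : Measure (unipDelta L e₁ d₁ hd₁ w₁ hw₁)) [ν₁.IsHaarMeasure] (μ : Matrix (Fin 1) (Fin 1) L) (x : HA L e₁ d₁ hd₁ w₁ hw₁) :
    DifferentiableOn ℂ (fun s => whittakerDelta L e₁ d₁ hd₁ w₁ hw₁ ν₁ μ (Φ (s + 1 / 2)) x) {s : ℂ | 0 < s.re} :=
  differentiableOn_whittakerDelta_shift_halfPlane L e₁ d₁ hd₁ w₁ hw₁ hd0 hw0 hχ hΦ hΦc ν₁ μ x (c := 1 / 2) (by norm_num)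

/-- **THE RANK-ONE LETTER FOR AN ENVELOPED PULL-BACK** (`n = 1`, `c = 1∕2`): sections of `I⁽¹⁾(s + ½, χ)` on the doubled line, holomorphic on `{0 < re s}`,
continuous, enveloped on the strips of `{0 < re s}` ⇒ `s ↦ W⁽¹⁾_μ(Φ_s)(x)` is `DifferentiableOn ℂ {0 < re s}` — the `hEbd` letter of the K1-b♮ line term
for the corner-translate family of (KW1-e), every line index `μ`, every `x ∈ H₁(𝔸)`. [cite: KudlaRallis1994, §1–§2] [cite: Tan1999, §3 (`n = 1`)] -/
theorem differentiableOn_whittakerDelta_line_of_envelope {N₁ M₁ : ℕ} (e₁ : Fin N₁ × Fin M₁ ≃ Fin 1)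
    (d₁ : Fin N₁ → L) (hd₁ : ∀ i, IsCMField.complexConj L (d₁ i) = d₁ i) (w₁ : Fin M₁ → L) (hw₁ : ∀ i, IsCMField.complexConj L (w₁ i) = w₁ i)
    [MeasurableSpace (unipDelta L e₁ d₁ hd₁ w₁ hw₁)] [BorelSpace (unipDelta L e₁ d₁ hd₁ w₁ hw₁)]
    (hd0 : ∀ i, d₁ i ≠ 0) (hw0 : ∀ i, w₁ i ≠ 0) {χ : HeckeCharacter L} (hχ : χ.IsUnitary)
    {Φ : ℂ → HA L e₁ d₁ hd₁ w₁ hw₁ → ℂ} (hsec : ∀ s : ℂ, IsSiegelDeltaSection L e₁ d₁ hd₁ w₁ hw₁ χ (s + 1 / 2) (Φ s))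
    (hhol : ∀ y, DifferentiableOn ℂ (fun s => Φ s y) {s : ℂ | 0 < s.re}) (hcont : ∀ s, Continuous (Φ s))
    (henv : ∀ σ₀ σ₁ : ℝ, 0 < σ₀ → σ₀ ≤ σ₁ → ∃ C : ℝ, ∀ s : ℂ, σ₀ ≤ s.re → s.re ≤ σ₁ →
      ∀ y : HA L e₁ d₁ hd₁ w₁ hw₁, ‖Φ s y‖ ≤ C * (‖Φ (σ₀ : ℂ) y‖ + ‖Φ (σ₁ : ℂ) y‖))
    (ν₁ : Measure (unipDelta L e₁ d₁ hd₁ w₁ hw₁)) [ν₁.IsHaarMeasure] (μ : Matrix (Fin 1) (Fin 1) L) (x : HA L e₁ d₁ hd₁ w₁ hw₁) :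
    DifferentiableOn ℂ (fun s => whittakerDelta L e₁ d₁ hd₁ w₁ hw₁ ν₁ μ (Φ s) x) {s : ℂ | 0 < s.re} := by
  have hw : {s : ℂ | ((1 : ℕ) : ℝ) / 2 - (1 / 2 : ℂ).re < s.re} = {s : ℂ | 0 < s.re} := by
    ext s; norm_num
  have h := differentiableOn_whittakerDelta_of_envelope L e₁ d₁ hd₁ w₁ hw₁ hd0 hw0 hχ (1 / 2) hsec (by rwa [hw]) hcont
    (fun σ₀ σ₁ h₀ h₁ => henv σ₀ σ₁ (by norm_num at h₀; exact h₀) h₁) ν₁ μ x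
  rwa [hw] at h

end Shift

end Summit.HodgeConjecture.HodgeConjecture.Cruxes.HLiu418.K2LiuKindOneLineWhittakerHolomorphy

end
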